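import Summits.CriticalPhenomena.Ising3DConformalLimit.Theorems.PerfectScreeningCoulombImpliesNontrivialDepletionCeiling
import Mathlib.Analysis.SumIntegralComparisons
import Mathlib.Analysis.SpecialFunctions.Integrals.Basic
import Mathlib.Analysis.SpecialFunctions.Pow.Asymptotics
import HarnessLib

/-!
# Crux `CoulombImpliesNontrivial` (stmt-CriticalPhenomena-13885), line `merging-is-expected-screening`:
# in the Coulomb world NO exponent `s < 1` can witness `stub_isingCapacityAxial`

Companion of `…DepletionCeiling` (p141427). The open registered stub of the line is existential in the exponent,
`∃ s ∈ (0,2), Cap(s)`, where `Cap(s)` says that for all `K, λ, ν > 0` every spread `s`-dimensional free defect near an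
axial pair depletes the critical free-box two-point function by a uniform fraction. This file proves, sorry-free,
that UNDER THE CRUX'S OWN ANTECEDENT (the Coulomb lower bound `c₀/‖x‖ ≤ G`) `Cap(s)` is FALSE for every
`s ∈ (0,1)` (`coulomb_not_capacity_of_lt_one`): the far axial dusts
`C_R = {(2R + i·a)e₀ : i < N}`, `N = ⌈Rˢ⌉`, `a = ⌊R/N⌋`, are admissible spread `s`-defects for
`(K, λ, ν) = (4, 4/(1−s), 1)` (mass `N ≥ Rˢ`; Riesz energy `≤ 2a^{−s}N^{2−s}/(1−s) ≤ λR^{−s}N²` by the power sum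
`∑_{k<N}(k+1)^{−s} ≤ N^{1−s}/(1−s)`, an integral comparison), they are `R`-far from both ends of the pair
`(0, R e₀)`, and the landed Coulomb-world ceiling `far_witness_card_lower` forces any such witness to have
`κ·c'·R ≤ #C_R = N ≤ Rˢ + 1` sites — impossible for large `R`. So inside this line (whose engine runs under the Coulomb
antecedent and consumes the stub only on far defects) the witness exponent lives in `[1, 2)`; the promoted item may be
filed with that window at no loss. Pure proofs; no definition, no named fact.

References: Aizenman–Duminil-Copin, Ann. Math. 194 (2021), App. A [AizenmanDuminilCopinAnnals2021];
Fröhlich–Simon–Spencer, CMP 50 (1976) [FrohlichSimonSpencer1976]; P. Mattila, Geometry of Sets and Measures (1995),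
Ch. 8 (Riesz energies) [Mattila1995].
-/

noncomputable section

open Filter Topology Set Finset MeasureTheory intervalIntegral
open Literature.Probability.LatticeModels Literature.Probability.Percolation
open Summit.CriticalPhenomena.Ising3DConformalLimit.Cruxes.IsingEuclidUpgradeR4NonGaussian.FreeCovarianceDeltaDichotomy
  (boxG)
open Summit.CriticalPhenomena.Ising3DConformalLimit.Cruxes.GaussianLimitNotScreened.KaramataAmplitudeBlindMerging
  (IsSpreadDefect defectG rieszEnergy)
open scoped symmDiff

namespace Summit.CriticalPhenomena.Ising3DConformalLimit.Cruxes.CoulombImpliesNontrivial.MergingIsExpectedScreening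

/-! ## §1. The power sum `∑_{k<N} (k+1)^{-s} ≤ N^{1-s}/(1-s)` -/

/-- `∑_{k<N} (k+1)^{-s} ≤ N^{1-s}/(1-s)` for `0 < s < 1`, `N ≥ 1` (integral comparison with `∫₁^N x^{-s} dx`).
[cite: Mattila1995, Chapter 8] -/
theorem sum_range_succ_rpow_neg_le {s : ℝ} (hs0 : 0 < s) (hs1 : s < 1) {N : ℕ} (hN : 1 ≤ N) :
    ∑ k ∈ Finset.range N, ((k : ℝ) + 1) ^ (-s) ≤ (N : ℝ) ^ (1 - s) / (1 - s) := by
  have h1s : 0 < 1 - s := by linarith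
  rw [Finset.sum_range_eq_add_Ico _ hN]
  simp only [CharP.cast_eq_zero, zero_add, Real.one_rpow]
  have hanti : AntitoneOn (fun x : ℝ => x ^ (-s)) (Icc (1 : ℕ) (N : ℕ)) := by
    intro x hx y _ hxy
    have hx1 : (0 : ℝ) < x := by
      have := hx.1; simp only [Nat.cast_one] at this; linarith
    exact Real.rpow_le_rpow_of_nonpos hx1 hxy (by linarith)
  have hcmp := AntitoneOn.sum_le_integral_Ico hN hanti
  have hint : ∫ x in ((1 : ℕ) : ℝ)..((N : ℕ) : ℝ), x ^ (-s) = ((N : ℝ) ^ (1 - s) - 1) / (1 - s) := by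
    rw [integral_rpow (Or.inl (by linarith))]
    simp only [Nat.cast_one, Real.one_rpow]
    rw [show -s + 1 = 1 - s by ring]
  have hsum : ∑ i ∈ Finset.Ico 1 N, ((i : ℝ) + 1) ^ (-s) = ∑ i ∈ Finset.Ico 1 N, (((i + 1 : ℕ) : ℝ)) ^ (-s) := by
    refine Finset.sum_congr rfl fun i _ => ?_
    push_cast; ring_nf
  rw [hsum]
  rw [hint] at hcmp
  have h3 : (1 : ℝ) ≤ 1 / (1 - s) := by
    rw [le_div_iff₀ h1s]; linarith
  calc 1 + ∑ i ∈ Finset.Ico 1 N, (((i + 1 : ℕ) : ℝ)) ^ (-s) ≤ 1 + ((N : ℝ) ^ (1 - s) - 1) / (1 - s) := by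
        linarith
    _ = (N : ℝ) ^ (1 - s) / (1 - s) + (1 - 1 / (1 - s)) := by ring
    _ ≤ (N : ℝ) ^ (1 - s) / (1 - s) := by linarith

/-- The two-sided inner sum: for `i < N`, `∑_{j<N, j≠i} |i-j|^{-s} ≤ 2·N^{1-s}/(1-s)`. [cite: Mattila1995, Chapter 8] -/
theorem sum_erase_abs_sub_rpow_neg_le {s : ℝ} (hs0 : 0 < s) (hs1 : s < 1) {N i : ℕ} (hi : i < N) :
    ∑ j ∈ (Finset.range N).erase i, |(i : ℝ) - j| ^ (-s) ≤ 2 * ((N : ℝ) ^ (1 - s) / (1 - s)) := by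
  have hN : 1 ≤ N := by omega
  set S := ∑ k ∈ Finset.range N, ((k : ℝ) + 1) ^ (-s) with hS
  have hSle := sum_range_succ_rpow_neg_le hs0 hs1 hN
  have hnonneg : ∀ j : ℕ, 0 ≤ |(i : ℝ) - j| ^ (-s) := fun j => Real.rpow_nonneg (abs_nonneg _) _
  -- split `(range N).erase i ⊆ range i ∪ Ico (i+1) N`
  have hsub : (Finset.range N).erase i ⊆ Finset.range i ∪ Finset.Ico (i + 1) N := by
    intro j hj
    rw [Finset.mem_erase, Finset.mem_range] at hj
    rw [Finset.mem_union, Finset.mem_range, Finset.mem_Ico]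
    omega
  have hdisj : Disjoint (Finset.range i) (Finset.Ico (i + 1) N) := by
    rw [Finset.disjoint_left]
    intro j hj hj'
    rw [Finset.mem_range] at hj; rw [Finset.mem_Ico] at hj'; omega
  have hleft : ∑ j ∈ Finset.range i, |(i : ℝ) - j| ^ (-s) ≤ S := by
    have hrefl := Finset.sum_range_reflect (fun j => |(i : ℝ) - (j : ℕ)| ^ (-s)) i
    rw [← hrefl]
    have heq : ∑ j ∈ Finset.range i, |(i : ℝ) - ((i - 1 - j : ℕ) : ℝ)| ^ (-s) =
        ∑ j ∈ Finset.range i, ((j : ℝ) + 1) ^ (-s) := by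
      refine Finset.sum_congr rfl fun j hj => ?_
      rw [Finset.mem_range] at hj
      rw [Nat.cast_sub (by omega), Nat.cast_sub (by omega)]
      congr 1
      rw [show (i : ℝ) - ((i : ℝ) - ((1 : ℕ) : ℝ) - (j : ℝ)) = (j : ℝ) + 1 by push_cast; ring]
      exact abs_of_nonneg (by positivity)
    rw [heq, hS]
    exact Finset.sum_le_sum_of_subset_of_nonneg (Finset.range_subset_range.2 hi.le)
      fun k _ _ => Real.rpow_nonneg (by positivity) _
  have hright : ∑ j ∈ Finset.Ico (i + 1) N, |(i : ℝ) - j| ^ (-s) ≤ S := by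
    rw [Finset.sum_Ico_eq_sum_range]
    have heq : ∑ k ∈ Finset.range (N - (i + 1)), |(i : ℝ) - ((i + 1 + k : ℕ) : ℝ)| ^ (-s) =
        ∑ k ∈ Finset.range (N - (i + 1)), ((k : ℝ) + 1) ^ (-s) := by
      refine Finset.sum_congr rfl fun k _ => ?_
      congr 1
      rw [show (i : ℝ) - ((i + 1 + k : ℕ) : ℝ) = -((k : ℝ) + 1) by push_cast; ring, abs_neg]
      exact abs_of_nonneg (by positivity)
    rw [heq, hS]
    exact Finset.sum_le_sum_of_subset_of_nonneg (Finset.range_subset_range.2 (by omega))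
      fun k _ _ => Real.rpow_nonneg (by positivity) _
  calc ∑ j ∈ (Finset.range N).erase i, |(i : ℝ) - j| ^ (-s)
      ≤ ∑ j ∈ Finset.range i ∪ Finset.Ico (i + 1) N, |(i : ℝ) - j| ^ (-s) :=
        Finset.sum_le_sum_of_subset_of_nonneg hsub fun j _ _ => hnonneg j
    _ = ∑ j ∈ Finset.range i, |(i : ℝ) - j| ^ (-s) + ∑ j ∈ Finset.Ico (i + 1) N, |(i : ℝ) - j| ^ (-s) :=
        Finset.sum_union hdisj
    _ ≤ S + S := add_le_add hleft hright
    _ ≤ 2 * ((N : ℝ) ^ (1 - s) / (1 - s)) := by linarith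

/-! ## §2. Norm bookkeeping for axial sites -/

/-- `‖z e₀‖ = |z|` for the sup norm of `ℤ³`. [folklore] -/
theorem norm_single_int (z : ℤ) : ‖(Pi.single 0 z : Site 3)‖ = |(z : ℝ)| := by
  rw [Pi.norm_single, Int.norm_eq_abs]

/-- `‖z e₀ - w e₀‖ = |z - w|`. [folklore] -/
theorem norm_single_sub_single (z w : ℤ) :
    ‖(Pi.single 0 z : Site 3) - Pi.single 0 w‖ = |((z : ℝ) - w)| := by
  rw [← Pi.single_sub, norm_single_int, Int.cast_sub]

/-! ## §3. The theorem -/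

/-- **In the Coulomb world no exponent `s < 1` witnesses the Ising-capacity stub.** Under the crux's antecedent
`c₀/‖x‖ ≤ ⟨σ₀σ_x⟩_{β_c}` (`x ≠ 0`), for every `0 < s < 1` the matrix of `stub_isingCapacityAxial` at exponent `s` is
FALSE: the far axial dusts `{(2R + i·a)e₀ : i < ⌈Rˢ⌉}`, `a = ⌊R/⌈Rˢ⌉⌋`, are admissible spread `s`-defects for
`(K, λ, ν) = (4, 4/(1−s), 1)` relative to the axial pair `(0, R e₀)`, `R`-far from both ends, with only `⌈Rˢ⌉` sites,
while the Coulomb-world ceiling `far_witness_card_lower` demands `κ·c'·R` sites of any far depletion witness.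
[cite: AizenmanDuminilCopinAnnals2021, arXiv:1912.07973 Appendix A.2, Proposition A.3] -/
theorem coulomb_not_capacity_of_lt_one
    (hCou : ∃ c₀ : ℝ, 0 < c₀ ∧ ∀ x : Site 3, x ≠ 0 → c₀ / ‖x‖ ≤ criticalTwoPoint 3 x)
    {s : ℝ} (hs0 : 0 < s) (hs1 : s < 1) :
    ¬ (∀ K lam nu : ℝ, 0 < K → 0 < lam → 0 < nu →
      ∃ c' : ℝ, 0 < c' ∧ c' ≤ 1 ∧ ∃ R₀ : ℝ, ∀ c e : Site 3, (∀ j : Fin 3, j ≠ 0 → e j = c j) →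
        R₀ ≤ ‖c - e‖ → ∀ᶠ L : ℕ in atTop, ∀ C : Finset (Site 3), c ∉ C → e ∉ C →
          IsSpreadDefect s K lam nu c e C → defectG L C c e ≤ (1 - c') * boxG L c e) := by
  intro hM
  have h1s : 0 < 1 - s := by linarith
  obtain ⟨κ, hκ, hfar⟩ := far_witness_card_lower hCou one_pos
  obtain ⟨c', hc', -, R₀, hR⟩ := hM 4 (4 / (1 - s)) 1 (by norm_num) (by positivity) one_pos
  -- choose `R` large: `R ≥ R₀`, `R ≥ 2`, `Rˢ + 1 ≤ R/2`, `Rˢ + 1 < κ c' R`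
  set μ : ℝ := min (1 / 4) (κ * c' / 4) with hμ
  have hμpos : 0 < μ := lt_min (by norm_num) (by positivity)
  have hμ1 : μ ≤ 1 / 4 := min_le_left _ _
  have hμ2 : μ ≤ κ * c' / 4 := min_le_right _ _
  have hpow : Tendsto (fun R : ℕ => (R : ℝ) ^ (-(1 - s))) atTop (𝓝 0) :=
    (tendsto_rpow_neg_atTop h1s).comp tendsto_natCast_atTop_atTop
  have hev : ∀ᶠ R : ℕ in atTop, R₀ ≤ (R : ℝ) ∧ 2 ≤ R ∧ (R : ℝ) ^ (-(1 - s)) ≤ μ ∧ 1 ≤ μ * R := by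
    refine (tendsto_natCast_atTop_atTop.eventually_ge_atTop R₀).and
      ((eventually_ge_atTop 2).and ((hpow.eventually_le_const hμpos).and ?_))
    have h := tendsto_natCast_atTop_atTop.eventually_ge_atTop (1 / μ)
    filter_upwards [h] with R hR
    rwa [div_le_iff₀ hμpos, mul_comm] at hR
  obtain ⟨R, hRR₀, hR2, hRpow, hRμ⟩ := hev.exists
  have hRpos : (0 : ℝ) < R := by exact_mod_cast (by omega : 0 < R)
  -- `Rˢ ≤ μ R`
  have hRs : (R : ℝ) ^ s ≤ μ * R := by
    have : (R : ℝ) ^ s = (R : ℝ) ^ (-(1 - s)) * R := by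
      rw [← Real.rpow_add_one hRpos.ne']
      ring_nf
    rw [this]
    exact mul_le_mul_of_nonneg_right hRpow hRpos.le
  have hRs1 : (R : ℝ) ^ s + 1 ≤ 2 * μ * R := by linarith
  -- the integers `N = ⌈Rˢ⌉`, `a = ⌊R/N⌋`
  set N : ℕ := ⌈(R : ℝ) ^ s⌉₊ with hNdef
  have hRspos : 0 < (R : ℝ) ^ s := Real.rpow_pos_of_pos hRpos s
  have hN1 : 1 ≤ N := Nat.one_le_iff_ne_zero.2 (Nat.ceil_pos.2 hRspos).ne'
  have hNle : (N : ℝ) ≤ (R : ℝ) ^ s + 1 := (Nat.ceil_lt_add_one hRspos.le).le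
  have hNge : (R : ℝ) ^ s ≤ N := Nat.le_ceil _
  have h2N : 2 * N ≤ R := by
    have : (2 * N : ℝ) ≤ R := by nlinarith
    exact_mod_cast this
  have hNR : N ≤ R := by omega
  set a : ℕ := R / N with hadef
  have hNpos : 0 < N := hN1
  have ha1 : 1 ≤ a := (Nat.le_div_iff_mul_le hNpos).2 (by simpa using hNR)
  have hNa : N * a ≤ R := by rw [hadef, mul_comm]; exact Nat.div_mul_le_self R N
  have hNa' : R < N * a + N := by
    have := Nat.div_add_mod R N
    have hmod := Nat.mod_lt R hNpos
    rw [hadef]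
    nlinarith
  have hNa2 : (R : ℝ) ≤ 2 * (N * a : ℕ) := by
    have h' : R ≤ 2 * (N * a) := by omega
    exact_mod_cast h'
  -- the pair and the dust
  set c : Site 3 := 0 with hcdef
  set e : Site 3 := Pi.single 0 (R : ℤ) with hedef
  set f : ℕ → Site 3 := fun i => Pi.single 0 (((2 * R + i * a : ℕ) : ℤ)) with hfdef
  have hf_inj : Function.Injective f := by
    intro i j hij
    have h := congrFun hij 0
    simp only [hfdef, Pi.single_eq_same, Nat.cast_inj] at h
    have : i * a = j * a := by omega
    exact Nat.eq_of_mul_eq_mul_right (by omega) this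
  set C : Finset (Site 3) := (Finset.range N).image f with hCdef
  have hce : c ≠ e := by
    intro h
    have := congrFun h 0
    simp only [hcdef, hedef, Pi.zero_apply, Pi.single_eq_same] at this
    omega
  have hnorm_ce : ‖c - e‖ = R := by
    rw [hcdef, hedef, zero_sub, norm_neg, norm_single_int]
    push_cast
    exact abs_of_nonneg hRpos.le
  have hmemC : ∀ v ∈ C, ∃ i, i < N ∧ v = f i := fun v hv => by
    obtain ⟨i, hi, rfl⟩ := Finset.mem_image.1 hv
    exact ⟨i, Finset.mem_range.1 hi, rfl⟩
  have hia : ∀ i, i < N → i * a ≤ R := fun i hi =>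
    le_trans (Nat.mul_le_mul_right a hi.le) hNa
  -- norms of the dust sites
  have hnorm_vc : ∀ i, ‖f i - c‖ = (2 * R + i * a : ℕ) := fun i => by
    rw [hcdef, sub_zero, hfdef, norm_single_int]
    push_cast
    exact abs_of_nonneg (by positivity)
  have hnorm_ev : ∀ i, ‖e - f i‖ = (R + i * a : ℕ) := fun i => by
    rw [hedef, hfdef, norm_single_sub_single]
    push_cast
    rw [show (R : ℝ) - (2 * R + i * a) = -((R : ℝ) + i * a) by ring, abs_neg]
    exact abs_of_nonneg (by positivity)
  have hcC : c ∉ C := fun h => by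
    obtain ⟨i, -, hi⟩ := hmemC c h
    have := hnorm_vc i
    rw [← hi, sub_self, norm_zero] at this
    have h' : (0 : ℝ) < (2 * R + i * a : ℕ) := by exact_mod_cast (by omega : 0 < 2 * R + i * a)
    linarith
  have heC : e ∉ C := fun h => by
    obtain ⟨i, -, hi⟩ := hmemC e h
    have := hnorm_ev i
    rw [← hi, sub_self, norm_zero] at this
    have h' : (0 : ℝ) < (R + i * a : ℕ) := by exact_mod_cast (by omega : 0 < R + i * a)
    linarith
  -- far (`θ = 1`)
  have hfarC : ∀ v ∈ C, 1 * ‖c - e‖ ≤ ‖v - c‖ ∧ 1 * ‖c - e‖ ≤ ‖e - v‖ := by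
    intro v hv
    obtain ⟨i, hi, rfl⟩ := hmemC v hv
    rw [one_mul, hnorm_ce, hnorm_vc, hnorm_ev]
    exact ⟨by exact_mod_cast (by omega : R ≤ 2 * R + i * a), by exact_mod_cast (by omega : R ≤ R + i * a)⟩
  -- card
  have hcard : C.card = N := by
    rw [hCdef, Finset.card_image_of_injective _ hf_inj, Finset.card_range]
  -- admissibility
  have hspread : IsSpreadDefect s 4 (4 / (1 - s)) 1 c e C := by
    refine ⟨fun v hv => ?_, ?_, ?_⟩
    · -- in the `4R`-ball
      obtain ⟨i, hi, rfl⟩ := hmemC v hv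
      rw [hnorm_vc, hnorm_ce]
      have := hia i hi
      exact_mod_cast (by omega : 2 * R + i * a ≤ 4 * R)
    · -- mass
      rw [hnorm_ce, one_mul, hcard]
      exact hNge
    · -- Riesz energy
      rw [hnorm_ce, hcard]
      have hinner : ∀ i, i < N → ∑ v ∈ C.erase (f i), (‖f i - v‖ : ℝ) ^ (-s) ≤
          (a : ℝ) ^ (-s) * (2 * ((N : ℝ) ^ (1 - s) / (1 - s))) := by
        intro i hi
        rw [hCdef, ← Finset.image_erase hf_inj, Finset.sum_image fun x _ y _ h => hf_inj h]
        have hterm : ∀ j ∈ (Finset.range N).erase i,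
            (‖f i - f j‖ : ℝ) ^ (-s) = (a : ℝ) ^ (-s) * |(i : ℝ) - j| ^ (-s) := by
          intro j _
          rw [hfdef, norm_single_sub_single]
          push_cast
          rw [show (2 * (R : ℝ) + i * a) - (2 * R + j * a) = (a : ℝ) * ((i : ℝ) - j) by ring, abs_mul,
            abs_of_nonneg (by positivity : (0 : ℝ) ≤ a),
            Real.mul_rpow (by positivity) (abs_nonneg _)]
        rw [Finset.sum_congr rfl hterm, ← Finset.mul_sum]
        exact mul_le_mul_of_nonneg_left (sum_erase_abs_sub_rpow_neg_le hs0 hs1 hi)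
          (Real.rpow_nonneg (by positivity) _)
      have htot : rieszEnergy s C ≤ (N : ℝ) * ((a : ℝ) ^ (-s) * (2 * ((N : ℝ) ^ (1 - s) / (1 - s)))) := by
        unfold rieszEnergy
        rw [hCdef, Finset.sum_image fun x _ y _ h => hf_inj h, ← hCdef]
        refine (Finset.sum_le_sum fun i hi => hinner i (Finset.mem_range.1 hi)).trans ?_
        rw [Finset.sum_const, Finset.card_range, nsmul_eq_mul]
      refine htot.trans ?_
      -- `N · a^{-s} · 2N^{1-s}/(1-s) ≤ (4/(1-s)) R^{-s} N²`, from `(Na)^{-s} ≤ (R/2)^{-s} ≤ 2R^{-s}`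
      have hapos : (0 : ℝ) < a := by exact_mod_cast (by omega : 0 < a)
      have hNposR : (0 : ℝ) < N := by exact_mod_cast hNpos
      have hNa_low : (R : ℝ) / 2 ≤ (N : ℝ) * a := by
        have : ((N * a : ℕ) : ℝ) = (N : ℝ) * a := by push_cast; ring
        rw [← this]; linarith
      have hpow1 : ((N : ℝ) * a) ^ (-s) ≤ ((R : ℝ) / 2) ^ (-s) :=
        Real.rpow_le_rpow_of_nonpos (by positivity) hNa_low (by linarith)
      have hpow2 : ((R : ℝ) / 2) ^ (-s) ≤ 2 * (R : ℝ) ^ (-s) := by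
        rw [Real.div_rpow hRpos.le (by norm_num), Real.rpow_neg (by norm_num : (0:ℝ) ≤ 2), div_eq_mul_inv,
          inv_inv, mul_comm]
        refine mul_le_mul_of_nonneg_right ?_ (Real.rpow_nonneg hRpos.le _)
        calc (2 : ℝ) ^ s ≤ (2 : ℝ) ^ (1 : ℝ) := Real.rpow_le_rpow_of_exponent_le (by norm_num) hs1.le
          _ = 2 := Real.rpow_one 2
      have hNs : (N : ℝ) ^ (1 - s) = N * (N : ℝ) ^ (-s) := by
        rw [sub_eq_add_neg, Real.rpow_add hNposR, Real.rpow_one]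
      have hNas : ((N : ℝ) * a) ^ (-s) = (N : ℝ) ^ (-s) * (a : ℝ) ^ (-s) :=
        Real.mul_rpow hNposR.le hapos.le
      have hkey : (N : ℝ) ^ (-s) * (a : ℝ) ^ (-s) ≤ 2 * (R : ℝ) ^ (-s) := by
        rw [← hNas]; exact hpow1.trans hpow2
      have hNN : (0 : ℝ) ≤ (N : ℝ) * N / (1 - s) := by positivity
      calc (N : ℝ) * ((a : ℝ) ^ (-s) * (2 * ((N : ℝ) ^ (1 - s) / (1 - s))))
          = 2 * ((N : ℝ) * N / (1 - s)) * ((N : ℝ) ^ (-s) * (a : ℝ) ^ (-s)) := by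
            rw [hNs]; ring
        _ ≤ 2 * ((N : ℝ) * N / (1 - s)) * (2 * (R : ℝ) ^ (-s)) :=
            mul_le_mul_of_nonneg_left hkey (by positivity)
        _ = 4 / (1 - s) * (R : ℝ) ^ (-s) * (N : ℝ) ^ 2 := by ring
  -- the stub at `(c, e)` and the dust `C`
  have haxial : ∀ j : Fin 3, j ≠ 0 → e j = c j := fun j hj => by
    rw [hedef, hcdef, Pi.single_eq_of_ne hj, Pi.zero_apply]
  have hdep : ∀ᶠ L : ℕ in atTop, defectG L C c e ≤ (1 - c') * boxG L c e :=
    (hR c e haxial (by rw [hnorm_ce]; exact hRR₀)).mono fun L hL => hL C hcC heC hspread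
  have hcount := hfar C c e c' hce hfarC hdep
  rw [hnorm_ce, hcard] at hcount
  -- `κ c' R ≤ N ≤ Rˢ + 1 ≤ 2μR ≤ κ c' R / 2`
  have : κ * c' * R ≤ κ * c' * R / 2 := by
    calc κ * c' * R ≤ (N : ℝ) := hcount
      _ ≤ (R : ℝ) ^ s + 1 := hNle
      _ ≤ 2 * μ * R := hRs1
      _ ≤ κ * c' * R / 2 := by nlinarith
  nlinarith [mul_pos (mul_pos hκ hc') hRpos]

/-! ## §4. The registered bookkeeping stub -/

/-- **Registered bookkeeping stub `stub_smallExponentsExcluded`** (crux stmt-CriticalPhenomena-13885, line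
`merging-is-expected-screening`): under the Coulomb antecedent of the crux, the matrix of `stub_isingCapacityAxial` fails
at every exponent `s ∈ (0,1)` — the line's witness exponent lives in `[1,2)`. [cite: AizenmanDuminilCopinAnnals2021, arXiv:1912.07973 Appendix A.2, Proposition A.3] -/
theorem stub_smallExponentsExcluded :
    (∃ c₀ : ℝ, 0 < c₀ ∧ ∀ x : Site 3, x ≠ 0 → c₀ / ‖x‖ ≤ criticalTwoPoint 3 x) →
      ∀ s : ℝ, 0 < s → s < 1 →
        ¬ (∀ K lam nu : ℝ, 0 < K → 0 < lam → 0 < nu →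
          ∃ c' : ℝ, 0 < c' ∧ c' ≤ 1 ∧ ∃ R₀ : ℝ, ∀ c e : Site 3, (∀ j : Fin 3, j ≠ 0 → e j = c j) →
            R₀ ≤ ‖c - e‖ → ∀ᶠ L : ℕ in atTop, ∀ C : Finset (Site 3), c ∉ C → e ∉ C →
              IsSpreadDefect s K lam nu c e C → defectG L C c e ≤ (1 - c') * boxG L c e) :=
  fun hCou _ hs0 hs1 => coulomb_not_capacity_of_lt_one hCou hs0 hs1

end Summit.CriticalPhenomena.Ising3DConformalLimit.Cruxes.CoulombImpliesNontrivial.MergingIsExpectedScreening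

end
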